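import Summits.QuantumFields.YangMills.Theorems.PoincareLipschitzPlanarStreamFunctionL2
import HarnessLib

/-!
# Crux `BlockLipschitzL` (stmt-QuantumFields-23533) ∕ `HistoryTailL` (stmt-QuantumFields-19936), LINE 25 «CompactnessTransfer»,
# the (TM) discharge ROAD (H) «SU(2) currents ⇒ H-system ⇒ 8π quantum», brick (H) — file H8 «THE PLANAR STREAM FUNCTION, `E³` BUNDLE WITH `L²_loc` VALUES» (row (i′) of ★w3 g16's RULING (α))

Cell `ym3-torus` (YM ladder rung R3 = continuum SU(2) Yang–Mills on T³ — a RUNG, NOT Clay: not d = 4, not infinite volume,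
not a mass gap); WIDTH helper seat `ym3-torus-px5` g9 (px19 g8's 16:10:09Z request (iii): «the EXACT door of (F)»);
`--supports stmt-QuantumFields-23533`; THEOREMS ONLY (0 `def`, 0 `sorry`, default heartbeats); imports H7
✓`…PlanarStreamFunctionL2` (★★★`exists_streamFunction_sq`, the scalar stream function with `‖B‖² ∈ L¹_loc`).

WHAT THIS FILE DOES.  ★★ `exists_streamFunction_bundle_sq` (+ ★★`doorH_sq`, the DOOR-H text with the extra row) — three weakly divergence-free `L²` planar fields `A a : E² → E²`
(`a : Fin 3`) have a stacked stream function `B : E² → E³` with weak gradient `GB : E² → (E² →L[ℝ] E³)` on the whole plane,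
`‖B‖² ∈ L¹_loc` (row (i′)), `(GB y e₀) a = −A a y 1`, `(GB y e₁) a = A a y 0` at every point and `∫ Σ_k ‖GB y e_k‖² < ∞` — the door through which the ROAD (H)
knit feeds the H-system energy-quantisation fact (F) [BrezisCoron1985, Lemma A.1] (`B` there is `E² → EuclideanSpace ℝ (Fin 3)`).
HONEST SCOPE.  Bookkeeping over H4; nothing of (GAP)∕(TM), (ZD), (C), S1″, K1, `MeanDeviationL`, `BlockLipschitzL`, `HistoryTailL` is
proved here.  YM₃ on T³ is rung R3, not Clay; YM gap NOT proved; no summit statement is proved here.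

References: V. Girault, P.-A. Raviart, Finite Element Methods for Navier–Stokes Equations (1986), Ch. I Thm. 3.1 [GiraultRaviart1986];
H. Brezis, J.-M. Coron, Arch. Rational Mech. Anal. 89 (1985) 21–56, Lemma A.1 [BrezisCoron1985].
-/

set_option autoImplicit false

noncomputable section

open scoped BigOperators Topology ContDiff InnerProductSpace
open MeasureTheory Set Filter Function TopologicalSpace Metric ContinuousLinearMap

namespace Summit.QuantumFields.YangMills.Theorems.PoincareLipschitzPlanarStreamFunctionBundleL2

open Literature.Analysis.FunctionSpaces (IsTestFunctionOn HasWeakFDerivOn)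
open Summit.QuantumFields.YangMills.Theorems.PoincareLipschitzPlanarStreamFunctionLetters (clm_apply_eq_vec2)
open Summit.QuantumFields.YangMills.Theorems.PoincareLipschitzPlanarStreamFunctionLimitLetters (locallyIntegrable_apply)
open Summit.QuantumFields.YangMills.Theorems.PoincareLipschitzPlanarStreamFunctionL2 (exists_streamFunction_sq)

/-! ## §6 The `E³`-valued bundle (the door of the H-system energy-quantisation fact) -/

/-- ★★ **THE PLANAR STREAM FUNCTION, `E³`-VALUED BUNDLE, WITH `L²_loc` VALUES** (px19 g8's door of the fact (F) [BrezisCoron1985, Lemma A.1]): for THREE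
weakly divergence-free `L²` planar fields `A a` (`a : Fin 3`) there are `B : E² → E³` and `GB : E² → (E² →L[ℝ] E³)` with
`HasWeakFDerivOn univ B GB`, `(GB y e₀) a = −A a y 1`, `(GB y e₁) a = A a y 0` for every `y, a`, and `∫ Σ_k ‖GB y e_k‖² < ∞` — the three
scalar stream functions of `exists_streamFunction` stacked along the standard basis of `E³ = EuclideanSpace ℝ (Fin 3)`.
[cite: GiraultRaviart1986, Ch. I Thm. 3.1] -/
theorem exists_streamFunction_bundle_sq
    {A : Fin 3 → EuclideanSpace ℝ (Fin 2) → EuclideanSpace ℝ (Fin 2)}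
    (hAm : ∀ a, AEStronglyMeasurable (A a) volume)
    (hA2 : ∀ a, Integrable (fun y => ‖A a y‖ ^ 2) volume)
    (hdiv : ∀ a, ∀ η : EuclideanSpace ℝ (Fin 2) → ℝ, ContDiff ℝ (⊤ : ℕ∞) η → HasCompactSupport η →
      ∫ y, ∑ k : Fin 2, fderiv ℝ η y (EuclideanSpace.single k (1:ℝ)) * A a y k = 0) :
    ∃ (B : EuclideanSpace ℝ (Fin 2) → EuclideanSpace ℝ (Fin 3))
      (GB : EuclideanSpace ℝ (Fin 2) → EuclideanSpace ℝ (Fin 2) →L[ℝ] EuclideanSpace ℝ (Fin 3)),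
      HasWeakFDerivOn ⟨univ, isOpen_univ⟩ volume B GB ∧
      LocallyIntegrable (fun y => ‖B y‖ ^ 2) volume ∧
      (∀ y a, (GB y (EuclideanSpace.single 0 (1:ℝ))) a = -A a y 1 ∧ (GB y (EuclideanSpace.single 1 (1:ℝ))) a = A a y 0) ∧
      Integrable (fun y => ∑ k : Fin 2, ‖GB y (EuclideanSpace.single k (1:ℝ))‖ ^ 2) volume := by
  choose B GB hW hB2 hGB _hint using fun a => exists_streamFunction_sq (hAm a) (hA2 a) (hdiv a)
  -- two local letters (the landed H5 `…Bundle` has them as theorems; kept local here to stay import-light)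
  have locallyIntegrable_smul_const : ∀ {c : EuclideanSpace ℝ (Fin 2) → ℝ}, LocallyIntegrable c volume →
      ∀ v : EuclideanSpace ℝ (Fin 3), LocallyIntegrable (fun y => c y • v) volume := by
    intro c hc v x
    obtain ⟨s, hs, hi⟩ := hc x
    exact ⟨s, hs, hi.smul_const v⟩
  have sum_smul_single_apply : ∀ (c : Fin 3 → ℝ) (a : Fin 3),
      (∑ b : Fin 3, c b • EuclideanSpace.single b (1:ℝ)) a = c a := by
    intro c a
    fin_cases a <;> simp [Fin.sum_univ_three]
  -- coordinates of the scalar weak gradients: `GB a y v = −v₀ A a y 1 + v₁ A a y 0`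
  have hGBlin : ∀ a y v, GB a y v = -(A a y 1) * v 0 + A a y 0 * v 1 := by
    intro a y v
    rw [clm_apply_eq_vec2 (GB a y) v, (hGB a y).1, (hGB a y).2]
    ring
  -- the stacked objects: `Bv = Σ_a B_a e_a`, `GBv y = proj₀ ⊗ U y + proj₁ ⊗ V y` with `U = Σ_a (−A a · 1) e_a`, `V = Σ_a (A a · 0) e_a`
  set Bv : EuclideanSpace ℝ (Fin 2) → EuclideanSpace ℝ (Fin 3) :=
    fun y => ∑ a : Fin 3, B a y • EuclideanSpace.single a (1:ℝ) with hBv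
  set U : EuclideanSpace ℝ (Fin 2) → EuclideanSpace ℝ (Fin 3) :=
    fun y => ∑ a : Fin 3, (-(A a y 1)) • EuclideanSpace.single a (1:ℝ) with hU
  set V : EuclideanSpace ℝ (Fin 2) → EuclideanSpace ℝ (Fin 3) :=
    fun y => ∑ a : Fin 3, (A a y 0) • EuclideanSpace.single a (1:ℝ) with hV
  set GBv : EuclideanSpace ℝ (Fin 2) → EuclideanSpace ℝ (Fin 2) →L[ℝ] EuclideanSpace ℝ (Fin 3) :=
    fun y => (EuclideanSpace.proj (0 : Fin 2) : EuclideanSpace ℝ (Fin 2) →L[ℝ] ℝ).smulRight (U y) +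
      (EuclideanSpace.proj (1 : Fin 2) : EuclideanSpace ℝ (Fin 2) →L[ℝ] ℝ).smulRight (V y) with hGBv
  have hGBv_apply : ∀ y v, GBv y v = v 0 • U y + v 1 • V y := by
    intro y v
    rw [hGBv]
    simp [ContinuousLinearMap.smulRight_apply]
  have hGBv_sum : ∀ y v, GBv y v = ∑ a : Fin 3, (GB a y v) • EuclideanSpace.single a (1:ℝ) := by
    intro y v
    rw [hGBv_apply y v, hU, hV]
    simp only [Finset.smul_sum, smul_smul, ← Finset.sum_add_distrib, ← add_smul]
    refine Finset.sum_congr rfl fun a _ => ?_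
    rw [hGBlin a y v]
    ring_nf
  have hGBv_comp : ∀ y v a, (GBv y v) a = GB a y v := by
    intro y v a
    rw [hGBv_sum y v]
    exact sum_smul_single_apply (fun b => GB b y v) a
  -- local integrability
  have hAk : ∀ a (k : Fin 2), LocallyIntegrable (fun y => A a y k) volume := fun a => locallyIntegrable_apply (hAm a) (hA2 a)
  have hBloc : ∀ a, LocallyIntegrable (B a) volume := fun a =>
    locallyIntegrableOn_univ.1 (by simpa only [Opens.coe_mk] using (hW a).locallyIntegrableOn)
  have hBvloc : LocallyIntegrable Bv volume :=
    locallyIntegrable_finsetSum Finset.univ fun a _ => locallyIntegrable_smul_const (hBloc a) _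
  have hUloc : LocallyIntegrable U volume :=
    locallyIntegrable_finsetSum Finset.univ fun a _ => locallyIntegrable_smul_const ((hAk a 1).neg) _
  have hVloc : LocallyIntegrable V volume :=
    locallyIntegrable_finsetSum Finset.univ fun a _ => locallyIntegrable_smul_const (hAk a 0) _
  have hGBvloc : LocallyIntegrable GBv volume := by
    -- `GBv = Φ ∘ (U, V)` with `Φ(p, q) = proj₀ ⊗ p + proj₁ ⊗ q` continuous; norm bound `‖GBv y‖ ≤ ‖U y‖ + ‖V y‖`
    have hΦ : Continuous fun pq : EuclideanSpace ℝ (Fin 3) × EuclideanSpace ℝ (Fin 3) =>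
        (EuclideanSpace.proj (0 : Fin 2) : EuclideanSpace ℝ (Fin 2) →L[ℝ] ℝ).smulRight pq.1 +
          (EuclideanSpace.proj (1 : Fin 2) : EuclideanSpace ℝ (Fin 2) →L[ℝ] ℝ).smulRight pq.2 :=
      ((ContinuousLinearMap.smulRightL ℝ (EuclideanSpace ℝ (Fin 2)) (EuclideanSpace ℝ (Fin 3))
          (EuclideanSpace.proj (0 : Fin 2))).continuous.comp continuous_fst).add
        ((ContinuousLinearMap.smulRightL ℝ (EuclideanSpace ℝ (Fin 2)) (EuclideanSpace ℝ (Fin 3))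
          (EuclideanSpace.proj (1 : Fin 2))).continuous.comp continuous_snd)
    have hnorm_proj : ∀ k : Fin 2, ‖(EuclideanSpace.proj k : EuclideanSpace ℝ (Fin 2) →L[ℝ] ℝ)‖ ≤ 1 := by
      intro k
      refine ContinuousLinearMap.opNorm_le_bound _ zero_le_one fun v => ?_
      rw [one_mul]
      exact PiLp.norm_apply_le v k
    have hbound : ∀ y, ‖GBv y‖ ≤ ‖U y‖ + ‖V y‖ := by
      intro y
      rw [hGBv]
      refine (norm_add_le _ _).trans (add_le_add ?_ ?_)
      · rw [ContinuousLinearMap.norm_smulRight_apply]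
        exact (mul_le_of_le_one_left (norm_nonneg _) (hnorm_proj 0))
      · rw [ContinuousLinearMap.norm_smulRight_apply]
        exact (mul_le_of_le_one_left (norm_nonneg _) (hnorm_proj 1))
    intro x
    obtain ⟨s, hs, hiU⟩ := hUloc x
    obtain ⟨t, ht, hiV⟩ := hVloc x
    refine ⟨s ∩ t, Filter.inter_mem hs ht, ?_⟩
    have hiU' : IntegrableOn U (s ∩ t) volume := hiU.mono_set inter_subset_left
    have hiV' : IntegrableOn V (s ∩ t) volume := hiV.mono_set inter_subset_right
    have hmeas : AEStronglyMeasurable GBv (volume.restrict (s ∩ t)) := by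
      have h := hΦ.comp_aestronglyMeasurable (hiU'.aestronglyMeasurable.prodMk hiV'.aestronglyMeasurable)
      exact h
    exact Integrable.mono' (hiU'.norm.add hiV'.norm) hmeas (ae_of_all _ fun y => hbound y)
  -- integrability against test functions
  have htest_int : ∀ {g : EuclideanSpace ℝ (Fin 2) → ℝ}, Continuous g → HasCompactSupport g →
      ∀ a, Integrable (fun x => g x * B a x) volume ∧ ∀ v, Integrable (fun x => g x * GB a x v) volume := by
    intro g hg hgs a
    refine ⟨by simpa only [smul_eq_mul] using (hBloc a).integrable_smul_left_of_hasCompactSupport hg hgs, fun v => ?_⟩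
    have hloc : LocallyIntegrable (fun x => GB a x v) volume := by
      have heq : (fun x => GB a x v) = ((-(v 0)) • fun y => A a y 1) + ((v 1) • fun y => A a y 0) := by
        funext y
        simp only [Pi.add_apply, Pi.smul_apply, smul_eq_mul, hGBlin]
        ring
      rw [heq]
      exact ((hAk a 1).smul (-(v 0))).add ((hAk a 0).smul (v 1))
    simpa only [smul_eq_mul] using hloc.integrable_smul_left_of_hasCompactSupport hg hgs
  -- row (i′) for the bundle: `‖Bv y‖² = Σ_a (B a y)²`
  have hBv_sq : LocallyIntegrable (fun y => ‖Bv y‖ ^ 2) volume := by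
    have heq : (fun y => ‖Bv y‖ ^ 2) = fun y => ∑ a : Fin 3, ‖B a y‖ ^ 2 := by
      funext y
      rw [hBv]
      simp only [EuclideanSpace.real_norm_sq_eq, sum_smul_single_apply, Real.norm_eq_abs, sq_abs]
    rw [heq]
    exact locallyIntegrable_finsetSum Finset.univ fun a _ => hB2 a
  refine ⟨Bv, GBv, ⟨hBvloc.locallyIntegrableOn _, hGBvloc.locallyIntegrableOn _, ?_⟩, hBv_sq, fun y a => ⟨?_, ?_⟩, ?_⟩
  · -- the weak-derivative identity, componentwise from the scalar ones
    intro η v hη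
    have hηc : Continuous η := hη.contDiff.continuous
    have hgc : Continuous fun x => fderiv ℝ η x v := (hη.contDiff.continuous_fderiv (by simp)).clm_apply continuous_const
    have hgs : HasCompactSupport fun x => fderiv ℝ η x v :=
      (hη.hasCompactSupport.fderiv ℝ).mono fun x hx => by
        simp only [Function.mem_support, ne_eq] at hx ⊢
        intro h; exact hx (by rw [h, _root_.zero_apply])
    have hscal : ∀ a, ∫ x, fderiv ℝ η x v * B a x = -∫ x, η x * GB a x v := by
      intro a
      have key := (hW a).integral_fderiv_smul_eq η v hη
      simpa only [Opens.coe_mk, Measure.restrict_univ, smul_eq_mul] using key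
    show ∫ x in ((⟨univ, isOpen_univ⟩ : Opens (EuclideanSpace ℝ (Fin 2))) : Set (EuclideanSpace ℝ (Fin 2))), fderiv ℝ η x v • Bv x =
      -∫ x in ((⟨univ, isOpen_univ⟩ : Opens (EuclideanSpace ℝ (Fin 2))) : Set (EuclideanSpace ℝ (Fin 2))), η x • GBv x v
    simp only [Opens.coe_mk, Measure.restrict_univ]
    have hL : ∫ x, fderiv ℝ η x v • Bv x = ∑ a : Fin 3, (∫ x, fderiv ℝ η x v * B a x) • EuclideanSpace.single a (1:ℝ) := by
      have hre : ∀ x, fderiv ℝ η x v • Bv x = ∑ a : Fin 3, (fderiv ℝ η x v * B a x) • EuclideanSpace.single a (1:ℝ) := by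
        intro x
        rw [hBv]
        simp only [Finset.smul_sum, smul_smul]
      simp_rw [hre]
      rw [integral_finsetSum _ fun a _ => ((htest_int hgc hgs a).1).smul_const _]
      refine Finset.sum_congr rfl fun a _ => ?_
      rw [integral_smul_const]
    have hR : ∫ x, η x • GBv x v = ∑ a : Fin 3, (∫ x, η x * GB a x v) • EuclideanSpace.single a (1:ℝ) := by
      have hre : ∀ x, η x • GBv x v = ∑ a : Fin 3, (η x * GB a x v) • EuclideanSpace.single a (1:ℝ) := by
        intro x
        rw [hGBv_sum x v]
        simp only [Finset.smul_sum, smul_smul]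
      simp_rw [hre]
      rw [integral_finsetSum _ fun a _ => (((htest_int hηc hη.hasCompactSupport a).2 v)).smul_const _]
      refine Finset.sum_congr rfl fun a _ => ?_
      rw [integral_smul_const]
    rw [hL, hR, ← Finset.sum_neg_distrib]
    refine Finset.sum_congr rfl fun a _ => ?_
    rw [hscal a, neg_smul]
  · rw [hGBv_comp]; exact (hGB a y).1
  · rw [hGBv_comp]; exact (hGB a y).2
  · -- `∫ Σ_k ‖GB y e_k‖² = ∫ Σ_a ‖A a‖² < ∞`
    have hsum : Integrable (fun y => ∑ a : Fin 3, ‖A a y‖ ^ 2) volume := integrable_finsetSum _ fun a _ => hA2 a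
    refine hsum.congr (ae_of_all _ fun y => ?_)
    have hnorm : ∀ v, ‖GBv y v‖ ^ 2 = ∑ a : Fin 3, (GB a y v) ^ 2 := by
      intro v
      rw [EuclideanSpace.real_norm_sq_eq]
      exact Finset.sum_congr rfl fun a _ => by rw [hGBv_comp]
    show ∑ a : Fin 3, ‖A a y‖ ^ 2 = ∑ k : Fin 2, ‖GBv y (EuclideanSpace.single k (1:ℝ))‖ ^ 2
    rw [Fin.sum_univ_two, hnorm, hnorm, ← Finset.sum_add_distrib]
    refine Finset.sum_congr rfl fun a _ => ?_
    rw [(hGB a y).1, (hGB a y).2, EuclideanSpace.real_norm_sq_eq, Fin.sum_univ_two]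
    ring

/-- ★★ **DOOR-H′** — px19 g8's DOOR-H text (`DOOR-H-text.px19g8.txt`, a1ade6db15122e3c) with ★w3 g16's row (i′)
`LocallyIntegrable (fun y => ‖B y‖ ^ 2) volume` inserted after the Sobolev conjunct; discharged by `exists_streamFunction_bundle_sq`.
[cite: GiraultRaviart1986, Ch. I Thm. 3.1] -/
theorem doorH_sq : ∀ (A : Fin 3 → EuclideanSpace ℝ (Fin 2) → EuclideanSpace ℝ (Fin 2)),
      (∀ a, AEStronglyMeasurable (A a) volume) → (∀ a, Integrable (fun y => ‖A a y‖ ^ 2) volume) →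
      (∀ a (η : EuclideanSpace ℝ (Fin 2) → ℝ), ContDiff ℝ ∞ η → HasCompactSupport η →
        ∫ y, ∑ k : Fin 2, fderiv ℝ η y (EuclideanSpace.single k (1:ℝ)) * A a y k = 0) →
      ∃ (B : EuclideanSpace ℝ (Fin 2) → EuclideanSpace ℝ (Fin 3))
        (GB : EuclideanSpace ℝ (Fin 2) → (EuclideanSpace ℝ (Fin 2) →L[ℝ] EuclideanSpace ℝ (Fin 3))),
        HasWeakFDerivOn ⟨Set.univ, isOpen_univ⟩ volume B GB ∧
        LocallyIntegrable (fun y => ‖B y‖ ^ 2) volume ∧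
        (∀ y a, (GB y (EuclideanSpace.single 0 (1:ℝ))) a = -A a y 1 ∧ (GB y (EuclideanSpace.single 1 (1:ℝ))) a = A a y 0) ∧
        Integrable (fun y => ∑ k : Fin 2, ‖GB y (EuclideanSpace.single k (1:ℝ))‖ ^ 2) volume :=
  fun A hAm hA2 hdiv => exists_streamFunction_bundle_sq (A := A) hAm hA2 hdiv

end Summit.QuantumFields.YangMills.Theorems.PoincareLipschitzPlanarStreamFunctionBundleL2

end
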